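import Literature.NumberTheory.Automorphic.FuchsianEisensteinSeries
import Literature.NumberTheory.Automorphic.FundamentalDomainUnfolding
import Literature.NumberTheory.Automorphic.CuspidalSubspace
import Literature.NumberTheory.Automorphic.FuchsianCuspZones

/-!
# Incomplete Eisenstein series of a Fuchsian group and the unfolding Lemma 3.3
(Iwaniec, *Spectral Methods of Automorphic Forms*, GSM 53, §3.1 (3.2)–(3.3), §3.2 (3.12)–(3.15),
Lemma 3.3 (3.14), PDF pp. 40–44; §2.4, PDF pp. 34–35; Lemma 2.10, PDF p. 38)

Third general-`Γ` brick (after `FuchsianGroupCusps.lean`, `FuchsianEisensteinSeries.lean`) towards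
the finite-volume cases of `Iwaniec2002_thm_7_4` / `Iwaniec2002_eq_12_5` / `Iwaniec2002_thm_12_1`:
the incomplete Eisenstein series `E(z|ψ)` of an ARBITRARY discrete `Γ ≤ SL₂(ℝ)` (inside `GL₂(ℝ)`)
at the (scaled) cusp `∞`, and Iwaniec's Lemma 3.3 — the unfolding of `⟨E(·|ψ), f⟩` into the
strip — which in the book characterises the cusp forms as `𝓔(Γ\ℍ)^⊥` ((3.15)). The modular file
`IncompleteEisensteinSeries.lean` does this for `SL₂(ℤ)` through coprime pairs and the tree's
horocycle files; here everything is for a general group, PROVED, with no named facts.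

1. `incEis Γ ψ z = E(z|ψ) = Σ_{γ ∈ Γ_∞ \ Γ} ψ(Im γz) = ½ Σ_{rows (c,d)} ψ(y/|cz+d|²)` ((3.12); `tsum`
   over the rows of `Γ`, `Γ_∞ = B`, `-1 ∈ Γ`): a FINITE sum when `ψ = 0` on `(-∞, a)`, `a > 0`
   (`finite_support_rows`, Lemma 2.10), with `|E(z|ψ)| ≤ ‖ψ‖_∞ (1 + 36/a)` (`norm_incEis_le`),
   `Γ`-automorphic for every `ψ` (`incEis_smul`), vanishing for `Im z > max b (1/a)` when
   `supp ψ ⊆ [a, b]` (`incEis_eq_zero_of_lt_im` — "compact support in `Γ\ℍ`"), locally a finite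
   sum and continuous for continuous `ψ` (`continuous_incEis`).
2. **The cosets `Γ_∞ \ Γ` and the strip** `P = {0 ≤ Re w < 1}` (periods exactly `ℤ`, as after
   scaling, `Fuchsian.exists_scaling`): elements with the same bottom row differ by `T_n`
   (`exists_eq_upperRightHom_mul_of_row_eq`), each coset has exactly one element with `γz ∈ P`
   per sign, so `γ ↦ (c, d)` is a bijection `{γ ∈ Γ : γz ∈ P} → rows Γ` (`bijOn_row_strip`,
   `stripEquiv`; the strip is `cuspStrip 0` of `FuchsianCuspZones.lean`) and `Σ_{γ ∈ Γ} 𝟙_P(γz) G(c_γ, d_γ) = Σ_rows G` (`tsum_indicator_strip_eq`); with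
   automorphy, `Σ_{γ ∈ Γ} 𝟙_P(γz) ψ(Im γz) f(γz) = 2 E(z|ψ) f(z)` (`tsum_strip_smul_eq`).
3. **Lemma 3.3** (`setIntegral_incEis_mul`): for `F` a fundamental domain
   (`IsHypFundamentalDomain`), `ψ` continuous supported in `[a, b] ⊆ (0, ∞)`, `f` automorphic and
   continuous, `∫_F E(z|ψ) f(z) dμ = ∫₀^∞ ψ(y) f₀(y) y⁻² dy` with `f₀(y) = ∫₀¹ f(x+iy) dx`
   (the tree's `cuspMean` of `CuspidalSubspace.lean`, (3.2); bridge `setIntegral_Ico_eq_cuspMean`) — by 2 and the unfolding `∫_F Σ_γ φ(γz) dμ = 2∫_ℍ φ dμ` of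
   `FundamentalDomainUnfolding.lean`, the strip integral being computed in coordinates
   (`integral_strip_mul_eq`, integrability `integrableOn_stripIntegrand` from the compact rectangle
   `[0,1] × [a,b]`). Corollary `setIntegral_incEis`: `∫_F E(z|ψ) dμ = ∫₀^∞ ψ(y) y⁻² dy`.

Not here: smooth `ψ` and the decay (3.13), the space `𝓔(Γ\ℍ)` spanned by all cusps and (3.15) as
an orthogonal decomposition in `L²`, the inner product of two incomplete Eisenstein series via the
constant term of `E_𝔞(z, s)` ((3.17), needs Theorem 3.4).

## References
* [Iwaniec2002] H. Iwaniec, *Spectral Methods of Automorphic Forms*, 2nd ed., GSM 53, AMS 2002,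
  §3.1–3.2 and Lemma 3.3, PDF pp. 40–44; §2.4, PDF pp. 34–35; Lemma 2.10, PDF p. 38
  (held copy `book:iwaniec2002-spectral-methods-automorphic-forms`).
-/

noncomputable section

namespace Literature.NumberTheory.Automorphic

open Matrix UpperHalfPlane
open scoped MatrixGroups

namespace Fuchsian

variable {Γ : Subgroup (GL (Fin 2) ℝ)}

section IncompleteEisenstein

open _root_.MeasureTheory _root_.Set _root_.Filter
open scoped _root_.Pointwise _root_.ENNReal _root_.Topology

variable (Γ) in
/-- **The incomplete Eisenstein series** (3.12) of the cusp `∞` (normalised, `Γ_∞ = B`):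
`E(z|ψ) = Σ_{γ ∈ Γ_∞ \\ Γ} ψ(Im γz) = ½ Σ_{rows (c,d) of Γ} ψ(y/|cz + d|²)`, for any `ψ : ℝ → ℂ`
(a `tsum`; a finite sum when `ψ` vanishes near `0`, `finite_support_rows`). [cite: Iwaniec2002, §3.2 (3.12), PDF p. 43] -/
def incEis (ψ : ℝ → ℂ) (z : ℍ) : ℂ := (1 / 2) * ∑' r : rows Γ, ψ (rowIm r.1 z)

/-- If `ψ` vanishes on `(-∞, a)`, only rows of height `≥ a` contribute. [folklore] -/
theorem support_subset_highRows {ψ : ℝ → ℂ} {a : ℝ} (hψ : ∀ t < a, ψ t = 0) (ha : 0 < a) (z : ℍ) :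
    (Function.support fun r : rows Γ => ψ (rowIm r.1 z)) ⊆ {r | r.1 ∈ highRows Γ z (a / 2)} := by
  intro r hr
  refine ⟨r.2, ?_⟩
  by_contra hle
  rw [not_lt] at hle
  exact hr (hψ _ (by linarith))

/-- **`E(z|ψ)` is a finite sum** when `ψ` vanishes on `(-∞, a)`, `a > 0` (Lemma 2.10). [cite: Iwaniec2002, §3.2 & Lemma 2.10, PDF pp. 38, 43] -/
theorem finite_support_rows
    (hΓ : Γ ≤ (Matrix.SpecialLinearGroup.toGL : SL(2, ℝ) →* GL (Fin 2) ℝ).range)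
    (hd : IsDiscreteSubgroup Γ) (hT : Matrix.GeneralLinearGroup.upperRightHom (1 : ℝ) ∈ Γ)
    {ψ : ℝ → ℂ} {a : ℝ} (hψ : ∀ t < a, ψ t = 0) (ha : 0 < a) (z : ℍ) :
    (Function.support fun r : rows Γ => ψ (rowIm r.1 z)).Finite := by
  refine ((finite_highRows hΓ hd hT z (half_pos ha)).preimage Subtype.val_injective.injOn).subset ?_
  exact support_subset_highRows hψ ha z

/-- Hence the series is summable. [folklore] -/
theorem summable_incEis_term
    (hΓ : Γ ≤ (Matrix.SpecialLinearGroup.toGL : SL(2, ℝ) →* GL (Fin 2) ℝ).range)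
    (hd : IsDiscreteSubgroup Γ) (hT : Matrix.GeneralLinearGroup.upperRightHom (1 : ℝ) ∈ Γ)
    {ψ : ℝ → ℂ} {a : ℝ} (hψ : ∀ t < a, ψ t = 0) (ha : 0 < a) (z : ℍ) :
    Summable fun r : rows Γ => ψ (rowIm r.1 z) :=
  summable_of_hasFiniteSupport (finite_support_rows hΓ hd hT hψ ha z)

/-- **Bound**: `|E(z|ψ)| ≤ B (1 + 36/a)` if `|ψ| ≤ B` and `ψ = 0` on `(-∞, a)` (at most `2 + 72/a`
rows of height `> a/2`, Lemma 2.10). [cite: Iwaniec2002, Lemma 2.10 & §3.2, PDF pp. 38, 43] -/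
theorem norm_incEis_le
    (hΓ : Γ ≤ (Matrix.SpecialLinearGroup.toGL : SL(2, ℝ) →* GL (Fin 2) ℝ).range)
    (hd : IsDiscreteSubgroup Γ) (hT : Matrix.GeneralLinearGroup.upperRightHom (1 : ℝ) ∈ Γ)
    {ψ : ℝ → ℂ} {a B : ℝ} (hψ : ∀ t < a, ψ t = 0) (ha : 0 < a) (hB : ∀ t, ‖ψ t‖ ≤ B) (z : ℍ) :
    ‖incEis Γ ψ z‖ ≤ B * (1 + 36 / a) := by
  classical
  have hB0 : 0 ≤ B := (norm_nonneg _).trans (hB 0)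
  obtain ⟨hfin, hcard⟩ := ncard_highRows_le hΓ hd hT z (half_pos ha)
  set S : Finset (rows Γ) := (hfin.preimage Subtype.val_injective.injOn).toFinset with hS
  have hsupp : ∀ r : rows Γ, r ∉ S → ψ (rowIm r.1 z) = 0 := by
    intro r hr
    by_contra hne
    exact hr (by rw [hS, Set.Finite.mem_toFinset]; exact support_subset_highRows hψ ha z hne)
  unfold incEis
  rw [tsum_eq_sum hsupp, norm_mul]
  have hSc : (S.card : ℝ) ≤ 2 + 36 / (a / 2) := by
    refine le_trans ?_ hcard
    have : S.card ≤ (highRows Γ z (a / 2)).ncard := by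
      rw [Set.ncard_eq_toFinset_card _ hfin]
      refine Finset.card_le_card_of_injOn Subtype.val (fun r hr => ?_) (Subtype.val_injective.injOn)
      rw [Finset.mem_coe, hS, Set.Finite.mem_toFinset] at hr
      rw [Finset.mem_coe, Set.Finite.mem_toFinset]; exact hr
    exact_mod_cast this
  calc ‖(1 / 2 : ℂ)‖ * ‖∑ r ∈ S, ψ (rowIm r.1 z)‖ = (1 / 2) * ‖∑ r ∈ S, ψ (rowIm r.1 z)‖ := by
        rw [show ‖(1 / 2 : ℂ)‖ = 1 / 2 by simp]
    _ ≤ (1 / 2) * ∑ r ∈ S, ‖ψ (rowIm r.1 z)‖ :=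
        mul_le_mul_of_nonneg_left (norm_sum_le _ _) (by norm_num)
    _ ≤ (1 / 2) * ∑ _r ∈ S, B := by gcongr with r; exact hB _
    _ = (1 / 2) * (S.card * B) := by rw [Finset.sum_const, nsmul_eq_mul]
    _ ≤ (1 / 2) * ((2 + 36 / (a / 2)) * B) := by gcongr
    _ = B * (1 + 36 / a) := by field_simp

/-- **Automorphy of `E(·|ψ)`** for every `ψ`. [cite: Iwaniec2002, §3.1 (3.1) & §3.2 (3.12), PDF pp. 40, 43] -/
theorem incEis_smul
    (hΓ : Γ ≤ (Matrix.SpecialLinearGroup.toGL : SL(2, ℝ) →* GL (Fin 2) ℝ).range)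
    {γ₀ : GL (Fin 2) ℝ} (hγ₀ : γ₀ ∈ Γ) (ψ : ℝ → ℂ) (z : ℍ) :
    incEis Γ ψ (γ₀ • z) = incEis Γ ψ z := by
  unfold incEis
  rw [tsum_rows_smul hΓ hγ₀ ψ z]

/-- `E(·|ψ)` is `Γ`-automorphic. [cite: Iwaniec2002, §3.2 (3.12), PDF p. 43] -/
theorem isAutomorphic_incEis
    (hΓ : Γ ≤ (Matrix.SpecialLinearGroup.toGL : SL(2, ℝ) →* GL (Fin 2) ℝ).range) (ψ : ℝ → ℂ) :
    IsAutomorphic Γ (incEis Γ ψ) :=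
  fun _ hγ z => incEis_smul hΓ hγ ψ z

/-- Heights of rows with `c ≠ 0` are `≤ 1/y` (width one: `|c| ≥ 1`). [cite: Iwaniec2002, proof of Lemma 2.10, PDF p. 39] -/
theorem rowIm_le_inv_im
    (hΓ : Γ ≤ (Matrix.SpecialLinearGroup.toGL : SL(2, ℝ) →* GL (Fin 2) ℝ).range)
    (hd : IsDiscreteSubgroup Γ) (hT : Matrix.GeneralLinearGroup.upperRightHom (1 : ℝ) ∈ Γ)
    {r : Fin 2 → ℝ} (hr : r ∈ rows Γ) (h0 : r 0 ≠ 0) (z : ℍ) : rowIm r z ≤ 1 / z.im := by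
  have h1 := one_le_abs_of_mem_rows hΓ hd hT hr h0
  have hy := z.im_pos
  have hc2 : 1 ≤ (r 0) ^ 2 := by nlinarith [abs_nonneg (r 0), sq_abs (r 0)]
  have hden : 0 < (r 0 * z.re + r 1) ^ 2 + (r 0 * z.im) ^ 2 := by
    have : 0 < (r 0 * z.im) ^ 2 := by positivity
    nlinarith [sq_nonneg (r 0 * z.re + r 1)]
  rw [rowIm, normSq_rowDenom, div_le_div_iff₀ hden hy, one_mul]
  have h3 : z.im ^ 2 ≤ (r 0) ^ 2 * z.im ^ 2 := by nlinarith [sq_nonneg z.im]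
  nlinarith [sq_nonneg (r 0 * z.re + r 1)]

/-- **`E(z|ψ)` vanishes high in the cusp**: if `ψ` is supported in `[a, b]`, `a > 0`, then
`E(z|ψ) = 0` for `Im z > max b (1/a)` (the row `(0, ±1)` gives `ψ(y) = 0`, the others have
height `≤ 1/y < a`). [cite: Iwaniec2002, §3.2 ("`E_𝔞(z|ψ)` has compact support in `Γ\\ℍ`"), PDF p. 43] -/
theorem incEis_eq_zero_of_lt_im
    (hΓ : Γ ≤ (Matrix.SpecialLinearGroup.toGL : SL(2, ℝ) →* GL (Fin 2) ℝ).range)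
    (hd : IsDiscreteSubgroup Γ) (hT : Matrix.GeneralLinearGroup.upperRightHom (1 : ℝ) ∈ Γ)
    {ψ : ℝ → ℂ} {a b : ℝ} (ha : 0 < a) (hψa : ∀ t < a, ψ t = 0) (hψb : ∀ t > b, ψ t = 0)
    {z : ℍ} (hz : max b (1 / a) < z.im) : incEis Γ ψ z = 0 := by
  unfold incEis
  have h0 : (fun r : rows Γ => ψ (rowIm r.1 z)) = fun _ => 0 := by
    funext r
    by_cases hc : r.1 0 = 0
    · -- the rows `(0, ±1)` have height `y > b`
      have h1 : rowIm r.1 z = z.im := by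
        rw [rowIm, normSq_rowDenom, hc]
        rcases apply_one_eq_of_mem_rows hΓ hd hT r.2 hc with h | h <;> simp [h]
      rw [h1]
      exact hψb _ (lt_of_le_of_lt (le_max_left _ _) hz)
    · -- the others have height `≤ 1/y < a`
      have h1 := rowIm_le_inv_im hΓ hd hT r.2 hc z
      refine hψa _ (lt_of_le_of_lt h1 ?_)
      have hy : 1 / a < z.im := lt_of_le_of_lt (le_max_right _ _) hz
      rw [div_lt_iff₀ z.im_pos]
      rw [div_lt_iff₀ ha] at hy
      linarith
  rw [h0, tsum_zero, mul_zero]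

/-- The height `w ↦ Im_r w` is continuous. [folklore] -/
theorem continuous_rowIm {r : Fin 2 → ℝ} (hr : r ≠ 0) : Continuous fun z : ℍ => rowIm r z := by
  unfold rowIm rowDenom
  refine UpperHalfPlane.continuous_im.div ?_ fun z => (normSq_rowDenom_pos hr z).ne'
  exact Complex.continuous_normSq.comp ((continuous_const.mul UpperHalfPlane.continuous_coe).add continuous_const)

/-- **Local finiteness**: near `z₀` only the finitely many rows of height `> a/3` at `z₀` can
contribute to `E(w|ψ)` (`Im_r w ≤ e^{ρ(w, z₀)} Im_r z₀`). [folklore] -/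
theorem apply_rowIm_eq_zero_near
    (hΓ : Γ ≤ (Matrix.SpecialLinearGroup.toGL : SL(2, ℝ) →* GL (Fin 2) ℝ).range)
    {ψ : ℝ → ℂ} {a : ℝ} (hψ : ∀ t < a, ψ t = 0) (z₀ : ℍ) {w : ℍ} (hw : dist w z₀ < 1)
    (r : rows Γ) (hr : r.1 ∉ highRows Γ z₀ (a / 3)) : ψ (rowIm r.1 w) = 0 := by
  by_contra hne
  apply hr
  refine ⟨r.2, ?_⟩
  have h1 : a ≤ rowIm r.1 w := by
    by_contra hlt; rw [not_le] at hlt; exact hne (hψ _ hlt)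
  have h2 := rowIm_le_mul_exp_dist hΓ r.2 w z₀
  have h3 : Real.exp (dist w z₀) < 3 := by
    calc Real.exp (dist w z₀) ≤ Real.exp 1 := Real.exp_le_exp.mpr hw.le
      _ < 3 := Real.exp_one_lt_d9.trans (by norm_num)
  have h4 : 0 < rowIm r.1 z₀ := rowIm_pos (ne_zero_of_mem_rows r.2) z₀
  by_contra hle
  rw [not_lt] at hle
  nlinarith

/-- **Continuity of `E(·|ψ)`** for continuous `ψ` vanishing near `0` (locally a finite sum).
[cite: Iwaniec2002, §3.2, PDF p. 43] -/
theorem continuous_incEis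
    (hΓ : Γ ≤ (Matrix.SpecialLinearGroup.toGL : SL(2, ℝ) →* GL (Fin 2) ℝ).range)
    (hd : IsDiscreteSubgroup Γ) (hT : Matrix.GeneralLinearGroup.upperRightHom (1 : ℝ) ∈ Γ)
    {ψ : ℝ → ℂ} {a : ℝ} (hψc : Continuous ψ) (hψ : ∀ t < a, ψ t = 0) (ha : 0 < a) :
    Continuous (incEis Γ ψ) := by
  classical
  refine continuous_iff_continuousAt.mpr fun z₀ => ?_
  have hfin : {r : rows Γ | r.1 ∈ highRows Γ z₀ (a / 3)}.Finite :=
    (finite_highRows hΓ hd hT z₀ (by positivity)).preimage Subtype.val_injective.injOn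
  set S : Finset (rows Γ) := hfin.toFinset with hS
  have hloc : incEis Γ ψ =ᶠ[𝓝 z₀] fun w => (1 / 2) * ∑ r ∈ S, ψ (rowIm r.1 w) := by
    filter_upwards [Metric.ball_mem_nhds z₀ one_pos] with w hw
    unfold incEis
    congr 1
    refine tsum_eq_sum fun r hr => apply_rowIm_eq_zero_near hΓ hψ z₀ (Metric.mem_ball.mp hw) r ?_
    rwa [hS, Set.Finite.mem_toFinset] at hr
  refine ContinuousAt.congr ?_ hloc.symm
  refine (continuous_const.mul (continuous_finsetSum S fun r _ => ?_)).continuousAt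
  exact hψc.comp (continuous_rowIm (ne_zero_of_mem_rows r.2))

/-! ### The strip `P(0) = {0 ≤ Re w < 1}` (`cuspStrip 0` of `FuchsianCuspZones.lean`) and the cosets `Γ_∞ γ` (periods `= ℤ`) -/

/-- `T_1 ∈ Γ` when the periods are `ℤ`. [folklore] -/
theorem upperRightHom_one_mem_of_strictPeriods (hP : Γ.strictPeriods = AddSubgroup.zmultiples 1) :
    Matrix.GeneralLinearGroup.upperRightHom (1 : ℝ) ∈ Γ := by
  rw [← Subgroup.mem_strictPeriods_iff, hP]; exact AddSubgroup.mem_zmultiples _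

/-- The bottom row of `T_x γ` is that of `γ`. [folklore] -/
theorem row_upperRightHom_mul (x : ℝ) (γ : GL (Fin 2) ℝ) :
    ((Matrix.GeneralLinearGroup.upperRightHom x * γ : GL (Fin 2) ℝ) : Matrix (Fin 2) (Fin 2) ℝ) 1 =
      (γ : Matrix (Fin 2) (Fin 2) ℝ) 1 := by
  ext j
  simp [Matrix.mul_apply, Fin.sum_univ_two]

/-- **Elements with the same bottom row differ by an integral translation** (periods `= ℤ`):
the cosets `Γ_∞ γ` are the fibres of `γ ↦ (c, d)` up to `±`. [cite: Iwaniec2002, §2.4 (2.16)–(2.20), PDF pp. 34–35] -/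
theorem exists_eq_upperRightHom_mul_of_row_eq
    (hΓ : Γ ≤ (Matrix.SpecialLinearGroup.toGL : SL(2, ℝ) →* GL (Fin 2) ℝ).range)
    (hd : IsDiscreteSubgroup Γ) (hP : Γ.strictPeriods = AddSubgroup.zmultiples 1)
    {γ γ' : GL (Fin 2) ℝ} (hγ : γ ∈ Γ) (hγ' : γ' ∈ Γ)
    (hrow : (γ' : Matrix (Fin 2) (Fin 2) ℝ) 1 = (γ : Matrix (Fin 2) (Fin 2) ℝ) 1) :
    ∃ n : ℤ, γ' = Matrix.GeneralLinearGroup.upperRightHom (n : ℝ) * γ := by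
  have hT := upperRightHom_one_mem_of_strictPeriods hP
  set δ : GL (Fin 2) ℝ := γ' * γ⁻¹ with hδ
  have hδΓ : δ ∈ Γ := Γ.mul_mem hγ' (Γ.inv_mem hγ)
  obtain ⟨g, hg⟩ := hΓ hγ
  obtain ⟨g', hg'⟩ := hΓ hγ'
  have hc : δ 1 0 = 0 := by
    have e : δ = Matrix.SpecialLinearGroup.toGL (g' * g⁻¹) := by rw [map_mul, map_inv, hg, hg']
    have h0 : g' 1 0 = g 1 0 := by
      have := congr_fun hrow 0; rw [← hg, ← hg'] at this; exact this
    have h1 : g' 1 1 = g 1 1 := by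
      have := congr_fun hrow 1; rw [← hg, ← hg'] at this; exact this
    rw [e]
    show (g' * g⁻¹) 1 0 = 0
    simp [Matrix.mul_apply, Fin.sum_univ_two, Matrix.SpecialLinearGroup.coe_inv, Matrix.adjugate_fin_two, h0, h1]
    ring
  obtain ⟨x, hx | hx⟩ := eq_upperRightHom_or_neg_of_upperTriangular hΓ hd (isCusp_infty_of_mem hT) hδΓ hc
  · have hxP : x ∈ Γ.strictPeriods := by rw [Subgroup.mem_strictPeriods_iff, ← hx]; exact hδΓ
    rw [hP, AddSubgroup.mem_zmultiples_iff] at hxP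
    obtain ⟨n, rfl⟩ := hxP
    refine ⟨n, ?_⟩
    rw [show ((n : ℤ) : ℝ) = (n : ℤ) • (1 : ℝ) by simp, ← hx, hδ, inv_mul_cancel_right]
  · exfalso
    have e : γ' = -(Matrix.GeneralLinearGroup.upperRightHom x * γ) := by
      rw [← neg_mul, ← hx, hδ, inv_mul_cancel_right]
    have hr : (γ' : Matrix (Fin 2) (Fin 2) ℝ) 1 = -((γ : Matrix (Fin 2) (Fin 2) ℝ) 1) := by
      rw [e, Units.val_neg]
      ext j
      exact congrArg Neg.neg (congr_fun (row_upperRightHom_mul x γ) j)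
    rw [hrow] at hr
    have h2 : (γ : Matrix (Fin 2) (Fin 2) ℝ) 1 = 0 := by
      have : (2 : ℝ) • (γ : Matrix (Fin 2) (Fin 2) ℝ) 1 = 0 := by
        rw [two_smul]; nth_rewrite 2 [hr]; rw [add_neg_cancel]
      exact (smul_eq_zero.mp this).resolve_left two_ne_zero
    exact ne_zero_of_mem_rows (row_mem_rows hγ) h2

/-- `T_n γ z ∈ P` exactly for `n = -⌊Re γz⌋`. [folklore] -/
theorem upperRightHom_mul_smul_mem_strip_iff (γ : GL (Fin 2) ℝ) (z : ℍ) (n : ℤ) :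
    (Matrix.GeneralLinearGroup.upperRightHom (n : ℝ) * γ : GL (Fin 2) ℝ) • z ∈ cuspStrip 0 ↔
      n = -⌊(γ • z).re⌋ := by
  rw [mul_smul, upperRightHom_smul, mem_cuspStrip_iff, UpperHalfPlane.vadd_re, UpperHalfPlane.vadd_im]
  constructor
  · rintro ⟨h0, h1, -⟩
    have : ⌊(γ • z).re⌋ = -n := by
      rw [Int.floor_eq_iff]; push_cast; constructor <;> linarith
    omega
  · rintro rfl
    push_cast
    exact ⟨by linarith [Int.floor_le (γ • z).re], by linarith [Int.lt_floor_add_one (γ • z).re],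
      (γ • z).im_pos⟩

/-- **The cosets `Γ_∞ \\ Γ` as rows**: `γ ↦ (c, d)` is a bijection from `{γ ∈ Γ : γz ∈ P}` onto the
rows of `Γ` (every coset `Γ_∞ γ` has exactly one element `T_n γ` mapping `z` into the strip, for
each sign). [cite: Iwaniec2002, §2.4 & proof of Lemma 2.10 ("the number of `γ' ∈ Γ_𝔞` such that
`γ'γ` …"), PDF pp. 34–35, 39] -/
theorem bijOn_row_strip
    (hΓ : Γ ≤ (Matrix.SpecialLinearGroup.toGL : SL(2, ℝ) →* GL (Fin 2) ℝ).range)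
    (hd : IsDiscreteSubgroup Γ) (hP : Γ.strictPeriods = AddSubgroup.zmultiples 1) (z : ℍ) :
    Set.BijOn (fun γ : GL (Fin 2) ℝ => (γ : Matrix (Fin 2) (Fin 2) ℝ) 1)
      {γ | γ ∈ Γ ∧ γ • z ∈ cuspStrip 0} (rows Γ) := by
  have hT := upperRightHom_one_mem_of_strictPeriods hP
  refine ⟨fun γ hγ => row_mem_rows hγ.1, ?_, ?_⟩
  · rintro γ ⟨hγ, hγz⟩ γ' ⟨hγ', hγ'z⟩ hrow
    obtain ⟨n, rfl⟩ := exists_eq_upperRightHom_mul_of_row_eq hΓ hd hP hγ hγ' hrow.symm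
    have h0 : (Matrix.GeneralLinearGroup.upperRightHom ((0 : ℤ) : ℝ) * γ : GL (Fin 2) ℝ) • z ∈ cuspStrip 0 := by
      simpa using hγz
    rw [upperRightHom_mul_smul_mem_strip_iff] at hγ'z h0
    rw [← h0] at hγ'z
    rw [hγ'z]; simp
  · rintro r ⟨γ, hγ, rfl⟩
    refine ⟨Matrix.GeneralLinearGroup.upperRightHom (((-⌊(γ • z).re⌋ : ℤ)) : ℝ) * γ, ⟨?_, ?_⟩, ?_⟩
    · exact Γ.mul_mem (upperRightHom_intCast_mem hT _) hγ
    · exact (upperRightHom_mul_smul_mem_strip_iff γ z _).mpr rfl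
    · exact row_upperRightHom_mul _ γ

/-- The equivalence `{γ ∈ Γ : γz ∈ P} ≃ rows Γ` underlying the unfolding. [folklore] -/
def stripEquiv
    (hΓ : Γ ≤ (Matrix.SpecialLinearGroup.toGL : SL(2, ℝ) →* GL (Fin 2) ℝ).range)
    (hd : IsDiscreteSubgroup Γ) (hP : Γ.strictPeriods = AddSubgroup.zmultiples 1) (z : ℍ) :
    {γ : Γ // ((γ : GL (Fin 2) ℝ)) • z ∈ cuspStrip 0} ≃ rows Γ :=
  (Equiv.subtypeSubtypeEquivSubtypeInter (fun γ : GL (Fin 2) ℝ => γ ∈ Γ) (fun γ => γ • z ∈ cuspStrip 0)).trans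
    (bijOn_row_strip hΓ hd hP z).equiv

/-- **Summing over `Γ` against the strip = summing over the rows**:
`Σ_{γ ∈ Γ} 𝟙_P(γz) G(c_γ, d_γ) = Σ_{rows} G(c, d)`. [cite: Iwaniec2002, §3.2 (proof of Lemma 3.3: "by the unfolding method"), PDF p. 44] -/
theorem tsum_indicator_strip_eq
    (hΓ : Γ ≤ (Matrix.SpecialLinearGroup.toGL : SL(2, ℝ) →* GL (Fin 2) ℝ).range)
    (hd : IsDiscreteSubgroup Γ) (hP : Γ.strictPeriods = AddSubgroup.zmultiples 1)
    (G : (Fin 2 → ℝ) → ℂ) (z : ℍ) :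
    ∑' γ : Γ, (cuspStrip 0).indicator (fun _ => (1 : ℂ)) ((γ : GL (Fin 2) ℝ) • z) *
        G ((((γ : GL (Fin 2) ℝ)) : Matrix (Fin 2) (Fin 2) ℝ) 1) =
      ∑' r : rows Γ, G r.1 := by
  have e1 : (fun γ : Γ => (cuspStrip 0).indicator (fun _ => (1 : ℂ)) ((γ : GL (Fin 2) ℝ) • z) *
      G ((((γ : GL (Fin 2) ℝ)) : Matrix (Fin 2) (Fin 2) ℝ) 1)) =
      {γ : Γ | ((γ : GL (Fin 2) ℝ)) • z ∈ cuspStrip 0}.indicator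
        (fun γ : Γ => G ((((γ : GL (Fin 2) ℝ)) : Matrix (Fin 2) (Fin 2) ℝ) 1)) := by
    funext γ
    by_cases h : ((γ : GL (Fin 2) ℝ)) • z ∈ cuspStrip 0
    · rw [Set.indicator_of_mem h, one_mul, Set.indicator_of_mem (by exact h)]
    · rw [Set.indicator_of_notMem h, zero_mul, Set.indicator_of_notMem (by exact h)]
  rw [e1, ← _root_.tsum_subtype]
  exact (stripEquiv hΓ hd hP z).tsum_eq (fun r : rows Γ => G r.1)

/-! ### Lemma 3.3: unfolding `⟨E(·|ψ), f⟩` into the strip -/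

/-- **The unfolding identity, pointwise**: for `f` automorphic,
`Σ_{γ ∈ Γ} 𝟙_P(γz) ψ(Im γz) f(γz) = 2 E(z|ψ) f(z)`. [cite: Iwaniec2002, Lemma 3.3 (proof), PDF p. 44] -/
theorem tsum_strip_smul_eq
    (hΓ : Γ ≤ (Matrix.SpecialLinearGroup.toGL : SL(2, ℝ) →* GL (Fin 2) ℝ).range)
    (hd : IsDiscreteSubgroup Γ) (hP : Γ.strictPeriods = AddSubgroup.zmultiples 1)
    (ψ : ℝ → ℂ) {f : ℍ → ℂ} (hfa : IsAutomorphic Γ f) (z : ℍ) :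
    ∑' γ : Γ, (cuspStrip 0).indicator (fun _ => (1 : ℂ)) ((γ : GL (Fin 2) ℝ) • z) *
        (ψ (((γ : GL (Fin 2) ℝ) • z).im) * f ((γ : GL (Fin 2) ℝ) • z)) =
      2 * (incEis Γ ψ z * f z) := by
  have h := tsum_indicator_strip_eq hΓ hd hP (fun r => ψ (rowIm r z) * f z) z
  have e : (fun γ : Γ => (cuspStrip 0).indicator (fun _ => (1 : ℂ)) ((γ : GL (Fin 2) ℝ) • z) *
        (ψ (((γ : GL (Fin 2) ℝ) • z).im) * f ((γ : GL (Fin 2) ℝ) • z))) =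
      fun γ : Γ => (cuspStrip 0).indicator (fun _ => (1 : ℂ)) ((γ : GL (Fin 2) ℝ) • z) *
        (fun r : Fin 2 → ℝ => ψ (rowIm r z) * f z) ((((γ : GL (Fin 2) ℝ)) : Matrix (Fin 2) (Fin 2) ℝ) 1) := by
    funext γ
    simp only
    rw [im_smul_eq_rowIm (hΓ γ.2), hfa _ γ.2]
  rw [e, h, tsum_mul_right]
  unfold incEis
  ring

/-! ### Lemma 3.3: `∫_F E(z|ψ) f(z) dμ = ∫₀^∞ ψ(y) f₀(y) y⁻² dy` -/

/-- **The zeroth Fourier coefficient at `∞`** is the tree's cusp mean (`CuspidalSubspace.cuspMean`,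
(3.2)): for `y > 0`, `∫_{[0,1)} f(x + iy) dx = cuspMean f (iy) = ∫₀¹ f(ξ + iy) dξ`. [cite: Iwaniec2002, §3.1 (3.2)–(3.3), PDF pp. 40–41] -/
theorem setIntegral_Ico_eq_cuspMean (f : ℍ → ℂ) {y : ℝ} (hy : 0 < y) :
    ∫ x in Set.Ico (0 : ℝ) 1, f (UpperHalfPlane.ofComplex ⟨x, y⟩) =
      cuspMean f (UpperHalfPlane.ofComplex ⟨0, y⟩) := by
  rw [cuspMean, intervalIntegral.integral_of_le zero_le_one, MeasureTheory.integral_Ico_eq_integral_Ioo,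
    ← MeasureTheory.integral_Ioc_eq_integral_Ioo]
  refine setIntegral_congr_fun measurableSet_Ioc fun ξ _ => ?_
  have h1 : UpperHalfPlane.ofComplex (⟨ξ, y⟩ : ℂ) = ⟨⟨ξ, y⟩, hy⟩ :=
    UpperHalfPlane.ofComplex_apply_of_im_pos (z := (⟨ξ, y⟩ : ℂ)) hy
  have h2 : UpperHalfPlane.ofComplex (⟨0, y⟩ : ℂ) = ⟨⟨0, y⟩, hy⟩ :=
    UpperHalfPlane.ofComplex_apply_of_im_pos (z := (⟨0, y⟩ : ℂ)) hy
  rw [h1, h2]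
  congr 1
  ext1
  rw [UpperHalfPlane.coe_vadd]
  apply Complex.ext <;> simp

/-- `f ∘ ofComplex` is continuous on the open upper half-plane for continuous `f`. [folklore] -/
theorem continuousOn_comp_ofComplex {f : ℍ → ℂ} (hf : Continuous f) :
    ContinuousOn (f ∘ UpperHalfPlane.ofComplex) {z : ℂ | 0 < z.im} := by
  have hsrc : UpperHalfPlane.ofComplex.source = {z : ℂ | 0 < z.im} := by simp [UpperHalfPlane.ofComplex]
  rw [← hsrc]
  exact hf.comp_continuousOn UpperHalfPlane.ofComplex.continuousOn

/-- The strip integrand of Lemma 3.3 in Euclidean coordinates: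
`g(z) = y⁻² 𝟙_{[0,1)}(x) ψ(y) f(x + iy)`. [folklore] -/
def stripIntegrand (ψ : ℝ → ℂ) (f : ℍ → ℂ) (z : ℂ) : ℂ :=
  ((z.im ^ 2)⁻¹ : ℝ) • ((Set.Ico (0 : ℝ) 1).indicator (fun _ => (1 : ℂ)) z.re *
    (ψ z.im * f (UpperHalfPlane.ofComplex z)))

/-- On `{Im z > 0}` the strip integrand is the transport of `w ↦ 𝟙_P(w) ψ(Im w) f(w)`. [folklore] -/
theorem stripIntegrand_eq (ψ : ℝ → ℂ) (f : ℍ → ℂ) {z : ℂ} (hz : 0 < z.im) :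
    stripIntegrand ψ f z = ((z.im ^ 2)⁻¹ : ℝ) •
      ((cuspStrip 0).indicator (fun _ => (1 : ℂ)) (UpperHalfPlane.ofComplex z) *
        (ψ (UpperHalfPlane.ofComplex z).im * f (UpperHalfPlane.ofComplex z))) := by
  unfold stripIntegrand
  rw [UpperHalfPlane.ofComplex_apply_of_im_pos hz]
  congr 2
  by_cases h : 0 ≤ z.re ∧ z.re < 1
  · rw [Set.indicator_of_mem (show z.re ∈ Set.Ico (0 : ℝ) 1 from h),
      Set.indicator_of_mem (show (⟨z, hz⟩ : ℍ) ∈ cuspStrip 0 from ⟨h.1, h.2, hz⟩)]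
  · rw [Set.indicator_of_notMem (show z.re ∉ Set.Ico (0 : ℝ) 1 from h),
      Set.indicator_of_notMem (show (⟨z, hz⟩ : ℍ) ∉ cuspStrip 0 from fun h' => h ⟨h'.1, h'.2.1⟩)]

/-- **Integrability of the strip integrand** for continuous `ψ` supported in `[a, b]`, `a > 0`, and
continuous `f` (bounded on the compact rectangle `[0,1] × [a,b]`). [folklore] -/
theorem integrableOn_stripIntegrand {ψ : ℝ → ℂ} (hψc : Continuous ψ) {a b : ℝ} (ha : 0 < a)
    (hψa : ∀ t < a, ψ t = 0) (hψb : ∀ t > b, ψ t = 0) {f : ℍ → ℂ} (hfc : Continuous f) :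
    IntegrableOn (stripIntegrand ψ f) {z : ℂ | 0 < z.im} := by
  set U : Set ℂ := {z : ℂ | 0 < z.im} with hU
  set R : Set ℂ := Set.Icc (0 : ℝ) 1 ×ℂ Set.Icc a b with hR
  have hRc : IsCompact R := isCompact_Icc.reProdIm isCompact_Icc
  have hRU : R ⊆ U := fun z hz => lt_of_lt_of_le ha (Complex.mem_reProdIm.mp hz).2.1
  -- support
  have hsupp : Function.support (stripIntegrand ψ f) ⊆ R := by
    intro z hz
    rw [Function.mem_support] at hz
    rw [hR, Complex.mem_reProdIm, Set.mem_Icc, Set.mem_Icc]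
    by_contra hnot
    apply hz
    unfold stripIntegrand
    by_cases hx : z.re ∈ Set.Ico (0 : ℝ) 1
    · have hy : ¬ (a ≤ z.im ∧ z.im ≤ b) := fun h => hnot ⟨⟨hx.1, hx.2.le⟩, h⟩
      rcases not_and_or.mp hy with h | h
      · rw [hψa _ (not_le.mp h)]; simp
      · rw [hψb _ (not_le.mp h)]; simp
    · rw [Set.indicator_of_notMem hx]; simp
  -- measurability on `U`
  have hmeasU : MeasurableSet U := UpperHalfPlane.isOpen_upperHalfPlaneSet.measurableSet
  have hcont : ContinuousOn (fun z : ℂ => ψ z.im * f (UpperHalfPlane.ofComplex z)) U :=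
    (hψc.comp_continuousOn Complex.continuous_im.continuousOn).mul (continuousOn_comp_ofComplex hfc)
  have hae : AEStronglyMeasurable (stripIntegrand ψ f) (volume.restrict U) := by
    unfold stripIntegrand
    refine AEStronglyMeasurable.smul (𝕜 := ℝ) ?_ (AEStronglyMeasurable.mul ?_ (hcont.aestronglyMeasurable hmeasU))
    · exact (Complex.continuous_im.measurable.pow_const 2).inv.aestronglyMeasurable
    · exact ((measurable_const.indicator measurableSet_Ico).comp Complex.measurable_re).aestronglyMeasurable
  -- bound on `R`
  obtain ⟨Bf, hBf⟩ := hRc.exists_bound_of_continuousOn ((continuousOn_comp_ofComplex hfc).mono hRU)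
  obtain ⟨Bψ, hBψ⟩ := (isCompact_Icc : IsCompact (Set.Icc a b)).exists_bound_of_continuousOn hψc.continuousOn
  set M : ℝ := (a ^ 2)⁻¹ * (max Bψ 0 * max Bf 0) with hM
  have hbound : ∀ z, ‖stripIntegrand ψ f z‖ ≤ M := by
    intro z
    by_cases hz : z ∈ R
    · obtain ⟨hx, hy⟩ := Complex.mem_reProdIm.mp hz
      unfold stripIntegrand
      rw [norm_smul, norm_mul, Real.norm_of_nonneg (by positivity), norm_mul]
      have h1 : (z.im ^ 2)⁻¹ ≤ (a ^ 2)⁻¹ := by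
        have : a ^ 2 ≤ z.im ^ 2 := pow_le_pow_left₀ ha.le hy.1 2
        exact inv_anti₀ (by positivity) this
      have h2 : ‖(Set.Ico (0 : ℝ) 1).indicator (fun _ => (1 : ℂ)) z.re‖ ≤ 1 := by
        by_cases h : z.re ∈ Set.Ico (0 : ℝ) 1
        · rw [Set.indicator_of_mem h]; simp
        · rw [Set.indicator_of_notMem h]; simp
      have h3 : ‖ψ z.im‖ ≤ max Bψ 0 := (hBψ _ hy).trans (le_max_left _ _)
      have h4 : ‖f (UpperHalfPlane.ofComplex z)‖ ≤ max Bf 0 := (hBf z hz).trans (le_max_left _ _)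
      calc (z.im ^ 2)⁻¹ * (‖(Set.Ico (0 : ℝ) 1).indicator (fun _ => (1 : ℂ)) z.re‖ *
            (‖ψ z.im‖ * ‖f (UpperHalfPlane.ofComplex z)‖))
          ≤ (a ^ 2)⁻¹ * (1 * (max Bψ 0 * max Bf 0)) := by
            gcongr
        _ = M := by rw [hM, one_mul]
    · have : stripIntegrand ψ f z = 0 := by
        by_contra hne; exact hz (hsupp (Function.mem_support.mpr hne))
      rw [this, norm_zero, hM]; positivity
  -- integrable on `R` for the restricted measure, hence on `U`
  have hfinR : (volume.restrict U) R ≠ ∞ :=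
    ne_top_of_le_ne_top hRc.measure_lt_top.ne (Measure.restrict_apply_le _ _)
  have hintR : IntegrableOn (stripIntegrand ψ f) R (volume.restrict U) :=
    Measure.integrableOn_of_bounded hfinR hae (Filter.Eventually.of_forall fun z => hbound z)
  have := (integrableOn_iff_integrable_of_support_subset (μ := volume.restrict U) hsupp).mp hintR
  exact this

/-- The transported function `w ↦ 𝟙_P(w) ψ(Im w) f(w)` is integrable on `ℍ`. [folklore] -/
theorem integrable_strip_mul {ψ : ℝ → ℂ} (hψc : Continuous ψ) {a b : ℝ} (ha : 0 < a)
    (hψa : ∀ t < a, ψ t = 0) (hψb : ∀ t > b, ψ t = 0) {f : ℍ → ℂ} (hfc : Continuous f) :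
    Integrable fun w : ℍ => (cuspStrip 0).indicator (fun _ => (1 : ℂ)) w * (ψ w.im * f w) := by
  rw [integrable_upperHalfPlane_iff_integrableOn_complex]
  refine (integrableOn_stripIntegrand hψc ha hψa hψb hfc).congr_fun (fun z hz => ?_)
    UpperHalfPlane.isOpen_upperHalfPlaneSet.measurableSet
  exact stripIntegrand_eq ψ f hz

/-- **The strip integral in coordinates**: `∫_ℍ 𝟙_P ψ(Im) f dμ = ∫₀^∞ ψ(y) y⁻² f₀(y) dy`. [cite: Iwaniec2002, Lemma 3.3 (3.14), PDF p. 44] -/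
theorem integral_strip_mul_eq {ψ : ℝ → ℂ} (hψc : Continuous ψ) {a b : ℝ} (ha : 0 < a)
    (hψa : ∀ t < a, ψ t = 0) (hψb : ∀ t > b, ψ t = 0) {f : ℍ → ℂ} (hfc : Continuous f) :
    ∫ w : ℍ, (cuspStrip 0).indicator (fun _ => (1 : ℂ)) w * (ψ w.im * f w) =
      ∫ y in Set.Ioi (0 : ℝ), (ψ y * (((y ^ 2)⁻¹ : ℝ) : ℂ)) * cuspMean f (UpperHalfPlane.ofComplex ⟨0, y⟩) := by
  rw [integral_upperHalfPlane_eq_integral_complex]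
  have e1 : ∫ z in {z : ℂ | 0 < z.im}, ((z.im ^ 2)⁻¹ : ℝ) •
      ((cuspStrip 0).indicator (fun _ => (1 : ℂ)) (UpperHalfPlane.ofComplex z) *
        (ψ (UpperHalfPlane.ofComplex z).im * f (UpperHalfPlane.ofComplex z))) =
      ∫ z in {z : ℂ | 0 < z.im}, stripIntegrand ψ f z :=
    setIntegral_congr_fun UpperHalfPlane.isOpen_upperHalfPlaneSet.measurableSet
      fun z hz => (stripIntegrand_eq ψ f hz).symm
  rw [e1, setIntegral_upperHalf_eq_iterated _ (integrableOn_stripIntegrand hψc ha hψa hψb hfc)]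
  refine setIntegral_congr_fun measurableSet_Ioi fun y hy => ?_
  have hy' : (0 : ℝ) < y := hy
  rw [← setIntegral_Ico_eq_cuspMean f hy']
  unfold stripIntegrand
  simp only [Complex.real_smul]
  rw [← integral_const_mul, ← integral_indicator measurableSet_Ico]
  refine integral_congr_ae (Filter.Eventually.of_forall fun x => ?_)
  simp only [Set.indicator_apply, Set.mem_Ico]
  split_ifs
  · ring
  · simp

/-- **Iwaniec, Lemma 3.3 (the unfolding (3.14)) for a general group.** Let `Γ ≤ SL₂(ℝ)` (inside
`GL₂(ℝ)`) be discrete with `-1 ∈ Γ` and the cusp `∞` of periods exactly `ℤ` (`Γ_∞ = B`, as after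
scaling by `σ_𝔞`, `Fuchsian.exists_scaling`), `F` a fundamental domain, `ψ` continuous with support
in `[a, b] ⊆ (0, ∞)` and `f` automorphic and continuous. Then
`∫_F E(z|ψ) f(z) dμ(z) = ∫₀^∞ ψ(y) (∫₀¹ f(x + iy) dx) y⁻² dy`
(printed with `f̄` for the inner product `⟨E(·|ψ), f⟩`; apply it to `conj ∘ f`).
Proof: `2 E(z|ψ) f(z) = Σ_{γ ∈ Γ} 𝟙_P(γz) ψ(Im γz) f(γz)` (`tsum_strip_smul_eq`) and the unfolding
`∫_F Σ_γ φ(γz) = 2 ∫_ℍ φ` of `FundamentalDomainUnfolding.lean`. [cite: Iwaniec2002, Lemma 3.3 (3.14), PDF p. 44] -/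
theorem setIntegral_incEis_mul
    (hΓ : Γ ≤ (Matrix.SpecialLinearGroup.toGL : SL(2, ℝ) →* GL (Fin 2) ℝ).range)
    (hneg : (-1 : GL (Fin 2) ℝ) ∈ Γ) (hd : IsDiscreteSubgroup Γ)
    (hP : Γ.strictPeriods = AddSubgroup.zmultiples 1) {F : Set ℍ} (hF : IsHypFundamentalDomain Γ F)
    {ψ : ℝ → ℂ} (hψc : Continuous ψ) {a b : ℝ} (ha : 0 < a)
    (hψa : ∀ t < a, ψ t = 0) (hψb : ∀ t > b, ψ t = 0) {f : ℍ → ℂ} (hfa : IsAutomorphic Γ f)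
    (hfc : Continuous f) :
    ∫ z in F, incEis Γ ψ z * f z =
      ∫ y in Set.Ioi (0 : ℝ), (ψ y * (((y ^ 2)⁻¹ : ℝ) : ℂ)) * cuspMean f (UpperHalfPlane.ofComplex ⟨0, y⟩) := by
  set Φ : ℍ → ℂ := fun w => (cuspStrip 0).indicator (fun _ => (1 : ℂ)) w * (ψ w.im * f w) with hΦ
  have hΦi : Integrable Φ := integrable_strip_mul hψc ha hψa hψb hfc
  have hunf := setIntegral_tsum_smul_eq hΓ hneg hd.countable hF hΦi
  have hpt : ∀ z : ℍ, incEis Γ ψ z * f z = (1 / 2) * ∑' γ : Γ, Φ ((γ : GL (Fin 2) ℝ) • z) := by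
    intro z
    simp only [hΦ]
    rw [tsum_strip_smul_eq hΓ hd hP ψ hfa z]
    ring
  simp_rw [hpt]
  rw [integral_const_mul, hunf, ← integral_strip_mul_eq hψc ha hψa hψb hfc]
  ring

/-- **Corollary ((3.14) with `f = 1`)**: `∫_F E(z|ψ) dμ(z) = ∫₀^∞ ψ(y) y⁻² dy`. [cite: Iwaniec2002, Lemma 3.3, PDF p. 44] -/
theorem setIntegral_incEis
    (hΓ : Γ ≤ (Matrix.SpecialLinearGroup.toGL : SL(2, ℝ) →* GL (Fin 2) ℝ).range)
    (hneg : (-1 : GL (Fin 2) ℝ) ∈ Γ) (hd : IsDiscreteSubgroup Γ)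
    (hP : Γ.strictPeriods = AddSubgroup.zmultiples 1) {F : Set ℍ} (hF : IsHypFundamentalDomain Γ F)
    {ψ : ℝ → ℂ} (hψc : Continuous ψ) {a b : ℝ} (ha : 0 < a)
    (hψa : ∀ t < a, ψ t = 0) (hψb : ∀ t > b, ψ t = 0) :
    ∫ z in F, incEis Γ ψ z = ∫ y in Set.Ioi (0 : ℝ), ψ y * (((y ^ 2)⁻¹ : ℝ) : ℂ) := by
  have h := setIntegral_incEis_mul hΓ hneg hd hP hF hψc ha hψa hψb (f := fun _ => (1 : ℂ))
    (isAutomorphic_const Γ 1) continuous_const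
  simp only [mul_one] at h
  rw [h]
  refine setIntegral_congr_fun measurableSet_Ioi fun y _ => ?_
  simp [cuspMean]

end IncompleteEisenstein

end Fuchsian

end Literature.NumberTheory.Automorphic

end
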